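import Summits.HodgeConjecture.CorCM.OcticWeilMultiFrameTransfer
import Summits.HodgeConjecture.CorCM.OcticWeilFourfoldWeilParts
import Summits.HodgeConjecture.CorCM.QuadraticCMTypeSlice
import HarnessLib

/-!
# COR-CM — any number `r` of CM types over one octic CM field: the type counts read off a frame, and the Weil FOURFOLD parts
# (the four labels of a `(2,2)`-slot of one sign) of the weights of every product of copies of `E, B₁, …, B_r` have algebraic
# lines, GIVEN Markman's fourfold theorem

Cell `pub-hodgecm2` (COR-CM), seat b30 gen 25 (2026-08-23); count-neutral own lane OCTIC-MULTI (geometry half), sequel of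
`CorCM/OcticWeilMultiFrameTransfer.lean` (model map `toPtO` on `DecicWeil23Multi.multiSlots r`).  Theorems only; no definition, no
`sorry`; the ONE named fact is DISPLAYED as a hypothesis: `Markman2025_weilClasses_algebraic_abelianFourfold` (Markman 2025, unrefereed —
every rational class in `W_k ⊗ ℂ ⊕ W̄` of an abelian FOURFOLD of Weil type is algebraic).  The slot-generic twin of gen 20's
`CorCM/OcticWeilOrbitWeilParts.lean` (same proofs; gen 19's fibre lemmas `OcticWeilFourfold.card_filter_comp_eq_and_comp_mem_eq` /
`snd_eq_iff_comp_eq` and gen 18's `OcticCurveFourfold.card_filter_comp_eq_four` BY NAME).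

SETTING: `k = Kf i₀` quadratic, `K = Kf i₁` octic, `i : k → K`, slots `multiSlots r i₀ i₁ = (k, K, …, K)`, `A 0 = E ⊨ (k; {τ})`,
`A (m+1) = B_m ⊨ (K; Φ_(m+1))` read in a frame `e` as `s ∈ Φ_(m+1) ⟺ (e s).2 = P m (e s).1` (`hΦ`), `X = ⨁_j A(κ j)` for a slot
map `κ : Fin N → Fin (r+1)`.  A FOUR PART of slot `m`, sign `b` of a configuration of `X` (`Census.OcticWeilMulti.IsFourPartO`) is a
`4`-set with exactly one point over each label `(m, a, b)`, `a < 4` — the four embeddings of `K` over `τ_b` on copies of `B_m`,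
possibly SPREAD over up to four copies.

* §1 `typeCount_of_frameO` — `#{s ∈ Φ_(m+1) | s ∘ i = τ_b} = #{a | P m a = b}`; hence `typeCount_eq_two_of_frameO` (weight `2`:
  `k`-signature `(2,2)`, `B_m` of Weil type) and `typeCount_sixfold_of_frameO` (weight `1`: the count `(3,3)` of `(B_m × E) × E`).
* §2 `weilWeight_mem_pohlmannSetsAlgO` — the Weil weight `{(0, s) | s ∘ i = τ₁}` of the ONE-slot product `⨁_{Fin 1} B_m` is
  `Aut(ℂ)`-balanced from the type count alone; `weightClassesAlg_weilWeight_le_algebraicClasses_of_markmanO` (dimension `4` + the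
  cell's `CMWeights.weightClassesAlg_le_algebraicClasses_two_of_markman`) and, pulled back to `Y = ⨁ A` along `Fin 1 → Fin (r+1)`,
  `weightClassesAlg_weilWeightY_le_algebraicClasses_of_markmanO`.
* §3 `IsFourPartO.image_eq`; **`weightClassesAlg_le_algebraicClasses_of_isFourPartO`** — a four part of a `(2,2)`-slot of a weight
  of `X` has an algebraic line: its slot projection is injective with image the Weil weight of `Y` in slot `m+1` over `τ_b`; the
  distribution lemma (`CMWeights.weightClassesAlg_comp_le_algebraicClasses_of_injOn`) lifts algebraicity along `κ`.
HONEST FRAMING: conditional on the displayed Markman binder; `HC_CM` is not asserted.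
[cite: Markman2025SurveySecant, Thm. 1.2 and §1.1] [cite: MoonenZarhin1995Duke, Thm. 2.4] [cite: Deligne1982HodgeCycles, §4 Prop. 4.4]
[cite: Milne2020HodgeClassesAV, 1.2 (a) and Thm. 1]

## References
* [Markman2025SurveySecant] E. Markman, arXiv:2509.23403 (2025), Thm. 1.2, §1.1 (fourfolds of Weil type; unrefereed).
* [MoonenZarhin1999LowDim] B. Moonen, Yu. Zarhin, Math. Ann. 315 (1999), Thm. 0.2, (2.8).
* [Milne2020HodgeClassesAV] J. S. Milne, arXiv:2010.08857, 1.2 (a), Thm. 1.  [Deligne1982HodgeCycles] P. Deligne, LNM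
  900 (1982), §4 Prop. 4.4, §5 (c).  [MoonenZarhin1995Duke] B. Moonen, Yu. Zarhin, Duke Math. J. 77 (1995), Thm. 2.4.
-/

noncomputable section

open CategoryTheory CategoryTheory.Limits NumberField

namespace Summit.HodgeConjecture.CorCM.OcticWeilMulti

open Literature.AlgebraicGeometry Literature.AlgebraicGeometry.Motives Literature.AlgebraicGeometry.HodgeTheory
open Literature.AlgebraicGeometry.ComplexMultiplication (IsCMTypeRealisation)
open Literature.AlgebraicGeometry.Pohlmann1968
open Literature.AlgebraicTopology.SingularHomology
open Literature.NumberTheory.ComplexMultiplication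
open Summit.HodgeConjecture.CorCM.Census.OcticWeilMulti (PtO IsFourPartO)
open Summit.HodgeConjecture.CorCM.DecicWeil23Multi (multiSlots sigma_casesM)
open Summit.HodgeConjecture.CorCM.OcticCurveFourfold (comp_injective comp_eq_conjugate_of_snd_eq_false card_filter_comp_eq_four)
open Summit.HodgeConjecture.CorCM.OcticWeilFourfold (card_filter_comp_eq_and_comp_mem_eq snd_eq_iff_comp_eq)
open Summit.HodgeConjecture.CorCM.CMWeights (weightClassesAlg_comp_le_algebraicClasses_of_injOn
  weightClassesAlg_map_le_algebraicClasses weightClassesAlg_le_algebraicClasses_two_of_markman sum_finrank_eq_two_mul_dim)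
open Summit.HodgeConjecture.CorCM.DihedralSexticPairCurvePowers (ncard_sep_eq_card_filter)
open Summit.HodgeConjecture.CorCM.DihedralSexticPair (card_filter_equiv_mem)

open scoped Classical Pointwise

/-! ## §1 The type counts read off the frame -/

section TypeCount

variable {I : Type} {r : ℕ} {Kf : I → Type} [∀ i, Field (Kf i)] [∀ i, NumberField (Kf i)] [∀ i, IsCMField (Kf i)]
  {i₀ i₁ : I} {e : (Kf i₁ →+* ℂ) ≃ Fin 4 × Bool} {τ : Kf i₀ →+* ℂ} {i : Kf i₀ →+* Kf i₁} {P : Fin r → Fin 4 → Bool}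

omit [∀ i, NumberField (Kf i)] [∀ i, IsCMField (Kf i)] in
/-- The finite fact: the labels `(a, b')` with `b' = b ∧ b' = P m a` are the `(a, b)` with `P m a = b`. [folklore] -/
theorem card_filter_snd_eq_and (m : Fin r) (b : Bool) :
    ((Finset.univ : Finset (Fin 4 × Bool)).filter fun p => p.2 = b ∧ p.2 = P m p.1).card =
      ((Finset.univ : Finset (Fin 4)).filter fun a => P m a = b).card := by
  symm
  refine Finset.card_bij (fun a _ => (a, b)) (fun a ha => ?_) (fun a _ a' _ h => (Prod.mk.inj h).1) fun p hp => ?_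
  · obtain ⟨-, ha⟩ := Finset.mem_filter.1 ha
    exact Finset.mem_filter.2 ⟨Finset.mem_univ _, rfl, ha.symm⟩
  · obtain ⟨-, h1, h2⟩ := Finset.mem_filter.1 hp
    refine ⟨p.1, Finset.mem_filter.2 ⟨Finset.mem_univ _, ?_⟩, ?_⟩
    · rw [← h1]; exact h2.symm
    · rw [← h1]

omit [∀ i, IsCMField (Kf i)] in
/-- **The type count read off the frame**: for `s ∈ Φ ⟺ (e s).2 = P m (e s).1` and `(e s).2 = [s ∘ i = τ]`, the members of `Φ` over
`τ_b` (`τ_true = τ`, `τ_false = τ̄`) are counted by `#{a | P m a = b}`. [cite: Deligne1982HodgeCycles, §4 Prop. 4.4] -/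
theorem typeCount_of_frameO (hττ : ComplexEmbedding.conjugate τ ≠ τ)
    (hk : ∀ σ : Kf i₀ →+* ℂ, σ = τ ∨ σ = ComplexEmbedding.conjugate τ)
    (he_sign : ∀ s : Kf i₁ →+* ℂ, (e s).2 = true ↔ s.comp i = τ) {m : Fin r}
    {Φ : CMType (Kf i₁)} (hΦ : ∀ s : Kf i₁ →+* ℂ, s ∈ Φ.1 ↔ (e s).2 = P m (e s).1) (b : Bool) :
    (Finset.univ.filter fun s : Kf i₁ →+* ℂ =>
        s.comp i = (if b then τ else ComplexEmbedding.conjugate τ) ∧ s ∈ Φ.1).card =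
      ((Finset.univ : Finset (Fin 4)).filter fun a => P m a = b).card := by
  have hfilter : (Finset.univ.filter fun s : Kf i₁ →+* ℂ =>
      s.comp i = (if b then τ else ComplexEmbedding.conjugate τ) ∧ s ∈ Φ.1) =
      Finset.univ.filter fun s => e s ∈ ((Finset.univ : Finset (Fin 4 × Bool)).filter fun p => p.2 = b ∧ p.2 = P m p.1) := by
    refine Finset.filter_congr fun s _ => ?_
    rw [← snd_eq_iff_comp_eq hk hττ he_sign b s, hΦ s, Finset.mem_filter]
    exact ⟨fun h => ⟨Finset.mem_univ _, h⟩, fun h => h.2⟩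
  rw [hfilter, card_filter_equiv_mem, card_filter_snd_eq_and]

omit [∀ i, NumberField (Kf i)] [∀ i, IsCMField (Kf i)] in
/-- The complementary count: `#{a | P m a = false} = 4 − #{a | P m a = true}`. [folklore] -/
theorem card_filter_eq_false (m : Fin r) {w : ℕ} (hP : ((Finset.univ : Finset (Fin 4)).filter fun a => P m a = true).card = w) :
    ((Finset.univ : Finset (Fin 4)).filter fun a => P m a = false).card = 4 - w := by
  have h := Finset.card_filter_add_card_filter_not (s := (Finset.univ : Finset (Fin 4))) (fun a => P m a = true)
  rw [hP, Finset.card_univ, Fintype.card_fin] at h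
  have h' : ((Finset.univ : Finset (Fin 4)).filter fun a => ¬ P m a = true) =
      (Finset.univ : Finset (Fin 4)).filter fun a => P m a = false :=
    Finset.filter_congr fun a _ => by cases P m a <;> simp
  rw [← h']
  omega

/-- **The type count of a `(2,2)`-slot**: weight `#I_m = 2` ⟹ every complex embedding `τ'` of `k` has `#{s ∈ Φ : s ∘ i = τ'} = 2` —
`B_m` is an abelian fourfold of Weil type for `k`. [cite: Deligne1982HodgeCycles, §4 Prop. 4.4] [cite: MoonenZarhin1995Duke, Thm. 2.4] -/
theorem typeCount_eq_two_of_frameO (h2 : Module.finrank ℚ (Kf i₀) = 2)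
    (he_sign : ∀ s : Kf i₁ →+* ℂ, (e s).2 = true ↔ s.comp i = τ) {m : Fin r}
    (hP : ((Finset.univ : Finset (Fin 4)).filter fun a => P m a = true).card = 2)
    {Φ : CMType (Kf i₁)} (hΦ : ∀ s : Kf i₁ →+* ℂ, s ∈ Φ.1 ↔ (e s).2 = P m (e s).1) (τ' : Kf i₀ →+* ℂ) :
    (Finset.univ.filter fun s : Kf i₁ →+* ℂ => s.comp i = τ' ∧ s ∈ Φ.1).card = 2 := by
  have hττ : ComplexEmbedding.conjugate τ ≠ τ := QuarticCM.conjugate_ne τ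
  have hk : ∀ σ : Kf i₀ →+* ℂ, σ = τ ∨ σ = ComplexEmbedding.conjugate τ := fun σ =>
    QuarticCM.eq_or_eq_conjugate_of_quadratic h2 τ σ
  rcases hk τ' with rfl | rfl
  · have h := typeCount_of_frameO hττ hk he_sign hΦ true
    rw [if_pos rfl] at h
    rw [h, hP]
  · have h := typeCount_of_frameO hττ hk he_sign hΦ false
    rw [if_neg Bool.false_ne_true] at h
    rw [h, card_filter_eq_false m hP]

/-- **The type count of a `(1,3)`-slot against `Ψ = {τ}`**: weight `#I_m = 1` ⟹ `#{s ∈ Φ | s ∘ i = τ'} + 2·[τ' ∈ Ψ] = 3` for every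
`τ'` — the Weil-type condition `(3,3)` of the sixfold `(B_m × E) × E`. [cite: Deligne1982HodgeCycles, §5 (c)] -/
theorem typeCount_sixfold_of_frameO (h2 : Module.finrank ℚ (Kf i₀) = 2)
    (he_sign : ∀ s : Kf i₁ →+* ℂ, (e s).2 = true ↔ s.comp i = τ) {m : Fin r}
    (hP : ((Finset.univ : Finset (Fin 4)).filter fun a => P m a = true).card = 1)
    {Φ : CMType (Kf i₁)} (hΦ : ∀ s : Kf i₁ →+* ℂ, s ∈ Φ.1 ↔ (e s).2 = P m (e s).1)
    {Ψ : CMType (Kf i₀)} (hΨ : ∀ σ : Kf i₀ →+* ℂ, σ ∈ Ψ.1 ↔ σ = τ) (τ' : Kf i₀ →+* ℂ) :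
    (Finset.univ.filter fun s : Kf i₁ →+* ℂ => s.comp i = τ' ∧ s ∈ Φ.1).card + 2 * (if τ' ∈ Ψ.1 then 1 else 0) = 3 := by
  have hττ : ComplexEmbedding.conjugate τ ≠ τ := QuarticCM.conjugate_ne τ
  have hk : ∀ σ : Kf i₀ →+* ℂ, σ = τ ∨ σ = ComplexEmbedding.conjugate τ := fun σ =>
    QuarticCM.eq_or_eq_conjugate_of_quadratic h2 τ σ
  rcases hk τ' with rfl | rfl
  · have h := typeCount_of_frameO hττ hk he_sign hΦ true
    rw [if_pos rfl] at h
    rw [h, hP, if_pos ((hΨ _).2 rfl)]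
  · have h := typeCount_of_frameO hττ hk he_sign hΦ false
    rw [if_neg Bool.false_ne_true] at h
    have hnot : ComplexEmbedding.conjugate τ ∉ Ψ.1 := fun h' => hττ ((hΨ _).1 h')
    rw [h, card_filter_eq_false m hP, if_neg hnot]

end TypeCount

/-! ## §2 The Weil weight of the one-slot product `⨁_{Fin 1} B_m` is balanced and algebraic given Markman -/

section Markman

variable {I : Type} {r : ℕ} {Kf : I → Type} [∀ i, Field (Kf i)] [∀ i, NumberField (Kf i)] [∀ i, IsCMField (Kf i)]
  {i₀ i₁ : I} (i : Kf i₀ →+* Kf i₁) (m : Fin r)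
  {A : Fin (r + 1) → AbelianVariety ℂ} {Φ : ∀ j : Fin (r + 1), CMType (Kf (multiSlots r i₀ i₁ j))}
  {ι : ∀ j, 𝓞 (Kf (multiSlots r i₀ i₁ j)) →+* End (A j)}
  {θ : ∀ j, Kf (multiSlots r i₀ i₁ j) →+* Module.End ℂ (complexBetti (A j).X 1)}

omit [∀ i, NumberField (Kf i)] [∀ i, IsCMField (Kf i)] in
/-- The index map `s ↦ (0, s)` into the index set of the one-slot product `⨁_{Fin 1} B_m` is injective. [folklore] -/
theorem sigmaMk_one_injectiveO : Function.Injective fun s : Kf i₁ →+* ℂ =>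
    (⟨(0 : Fin 1), s⟩ : (j : Fin 1) × (Kf (multiSlots r i₀ i₁ ((fun _ : Fin 1 => m.succ) j)) →+* ℂ)) :=
  fun s s' h => by cases h; rfl

omit [∀ i, IsCMField (Kf i)] in
/-- **THE WEIL WEIGHT of the one-slot product `⨁_{Fin 1} B_m` is `Aut(ℂ)`-balanced**: the weight `{(0, s) | s ∘ i = τ₁}`
(of the Weil line `⋀⁴ H¹(B_m)_{τ₁} ⊆ W_k(B_m) ⊗ ℂ`) lies in `pohlmannSetsAlg _ 2`, from the TYPE COUNT `#{s ∈ Φ_(m+1) | s ∘ i = τ'} = 2`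
alone — no Galois hypothesis. [cite: Deligne1982HodgeCycles, §4 Prop. 4.4] [cite: MoonenZarhin1995Duke, Thm. 2.4] -/
theorem weilWeight_mem_pohlmannSetsAlgO (h8 : Module.finrank ℚ (Kf i₁) = 8) (h2 : Module.finrank ℚ (Kf i₀) = 2)
    (hcount : ∀ τ' : Kf i₀ →+* ℂ,
      (Finset.univ.filter fun s : Kf i₁ →+* ℂ => s.comp i = τ' ∧ s ∈ (Φ m.succ).1).card = 2)
    (τ₁ : Kf i₀ →+* ℂ) :
    ((Finset.univ.filter fun s : Kf i₁ →+* ℂ => s.comp i = τ₁).image fun s : Kf i₁ →+* ℂ =>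
        (⟨(0 : Fin 1), s⟩ : (j : Fin 1) × (Kf (multiSlots r i₀ i₁ ((fun _ : Fin 1 => m.succ) j)) →+* ℂ))) ∈
      pohlmannSetsAlg (K := fun j : Fin 1 => Kf (multiSlots r i₀ i₁ ((fun _ : Fin 1 => m.succ) j)))
        (fun j => Φ ((fun _ : Fin 1 => m.succ) j)) 2 := by
  have h4 : ∀ τ' : Kf i₀ →+* ℂ, (Finset.univ.filter fun s : Kf i₁ →+* ℂ => s.comp i = τ').card = 4 :=
    card_filter_comp_eq_four i h8 h2
  have hci := Finset.card_image_of_injective (Finset.univ.filter fun s : Kf i₁ →+* ℂ => s.comp i = τ₁)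
    (sigmaMk_one_injectiveO (i₀ := i₀) (i₁ := i₁) m)
  refine ⟨by rw [hci, h4 τ₁], fun ρ => ?_⟩
  rw [ncard_sep_eq_card_filter, ncard_sep_eq_card_filter, Finset.filter_image, Finset.filter_image,
    Finset.card_image_of_injective _ (sigmaMk_one_injectiveO (i₀ := i₀) (i₁ := i₁) m),
    Finset.card_image_of_injective _ (sigmaMk_one_injectiveO (i₀ := i₀) (i₁ := i₁) m), Finset.filter_filter,
    Finset.filter_filter]
  obtain ⟨hin, hout⟩ := card_filter_comp_eq_and_comp_mem_eq i (Φ m.succ).1 h4 hcount ρ τ₁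
  exact hin.trans hout.symm

variable (hA : ∀ j, IsCMTypeRealisation (Φ j) (A j) (ι j) (θ j))

include hA in
omit [∀ i, IsCMField (Kf i)] in
/-- The one-slot product `⨁_{Fin 1} B_m` has dimension `4` (`[K:ℚ] = 8`). [folklore] -/
theorem dim_biproduct_one_eq_fourO (h8 : Module.finrank ℚ (Kf i₁) = 8) :
    (⨁ fun j : Fin 1 => A ((fun _ : Fin 1 => m.succ) j)).dim = 4 := by
  have h := sum_finrank_eq_two_mul_dim (K := fun j : Fin 1 => Kf (multiSlots r i₀ i₁ ((fun _ : Fin 1 => m.succ) j)))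
    (fun j => hA ((fun _ : Fin 1 => m.succ) j))
  rw [Fin.sum_univ_one] at h
  change Module.finrank ℚ (Kf i₁) = _ at h
  omega

include hA in
/-- **The Weil weight of `⨁_{Fin 1} B_m` has an algebraic line, GIVEN Markman's theorem**: dimension `4` and balanced
(`weilWeight_mem_pohlmannSetsAlgO`), so the cell's `CMWeights.weightClassesAlg_le_algebraicClasses_two_of_markman` applies (the Weil
line `⋀⁴ H¹(B_m)_{τ₁}` of `W_k(B_m) ⊗ ℂ`). [cite: Markman2025SurveySecant, Thm. 1.2 and §1.1] [cite: MoonenZarhin1995Duke, Thm. 2.4] -/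
theorem weightClassesAlg_weilWeight_le_algebraicClasses_of_markmanO
    (hW4 : Markman2025_weilClasses_algebraic_abelianFourfold)
    (h8 : Module.finrank ℚ (Kf i₁) = 8) (h2 : Module.finrank ℚ (Kf i₀) = 2)
    (hcount : ∀ τ' : Kf i₀ →+* ℂ,
      (Finset.univ.filter fun s : Kf i₁ →+* ℂ => s.comp i = τ' ∧ s ∈ (Φ m.succ).1).card = 2)
    (τ₁ : Kf i₀ →+* ℂ) :
    weightClassesAlg (fun j : Fin 1 => A ((fun _ : Fin 1 => m.succ) j))
        (fun j => ι ((fun _ : Fin 1 => m.succ) j)) (2 * 2)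
        ((Finset.univ.filter fun s : Kf i₁ →+* ℂ => s.comp i = τ₁).image fun s : Kf i₁ →+* ℂ =>
          (⟨(0 : Fin 1), s⟩ : (j : Fin 1) × (Kf (multiSlots r i₀ i₁ ((fun _ : Fin 1 => m.succ) j)) →+* ℂ))) ≤
      algebraicClasses (⨁ fun j : Fin 1 => A ((fun _ : Fin 1 => m.succ) j)).X 2 :=
  weightClassesAlg_le_algebraicClasses_two_of_markman hW4 (fun j => hA ((fun _ : Fin 1 => m.succ) j))
    (dim_biproduct_one_eq_fourO m hA h8) (weilWeight_mem_pohlmannSetsAlgO i m h8 h2 hcount τ₁)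

include hA in
/-- **… and so does the Weil weight `{(m+1, s) | s ∘ i = τ₁}` of `Y = E ⊞ B₁ ⊞ ⋯ ⊞ B_r`** (pull-back along the projection
`Y → ⨁_{Fin 1} B_m`: `CMWeights.weightClassesAlg_map_le_algebraicClasses`). [cite: MoonenZarhin1999LowDim, Thm. 0.2 and (2.8)]
[cite: Markman2025SurveySecant, Thm. 1.2] -/
theorem weightClassesAlg_weilWeightY_le_algebraicClasses_of_markmanO
    (hW4 : Markman2025_weilClasses_algebraic_abelianFourfold)
    (h8 : Module.finrank ℚ (Kf i₁) = 8) (h2 : Module.finrank ℚ (Kf i₀) = 2)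
    (hcount : ∀ τ' : Kf i₀ →+* ℂ,
      (Finset.univ.filter fun s : Kf i₁ →+* ℂ => s.comp i = τ' ∧ s ∈ (Φ m.succ).1).card = 2)
    (τ₁ : Kf i₀ →+* ℂ) :
    weightClassesAlg A ι (2 * 2)
        ((Finset.univ.filter fun s : Kf i₁ →+* ℂ => s.comp i = τ₁).image fun s : Kf i₁ →+* ℂ =>
          (⟨m.succ, s⟩ : (l : Fin (r + 1)) × (Kf (multiSlots r i₀ i₁ l) →+* ℂ))) ≤
      algebraicClasses (⨁ A).X 2 := by
  have he : Function.Injective (fun _ : Fin 1 => m.succ) := fun a b _ => Subsingleton.elim a b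
  have hS''card : ((Finset.univ.filter fun s : Kf i₁ →+* ℂ => s.comp i = τ₁).image fun s : Kf i₁ →+* ℂ =>
      (⟨(0 : Fin 1), s⟩ : (j : Fin 1) × (Kf (multiSlots r i₀ i₁ ((fun _ : Fin 1 => m.succ) j)) →+* ℂ))).card =
      2 * 2 := by
    rw [Finset.card_image_of_injective _ (sigmaMk_one_injectiveO (i₀ := i₀) (i₁ := i₁) m),
      card_filter_comp_eq_four i h8 h2 τ₁]
  have h := weightClassesAlg_map_le_algebraicClasses hA (fun _ : Fin 1 => m.succ) he hS''card
    (weightClassesAlg_weilWeight_le_algebraicClasses_of_markmanO i m hA hW4 h8 h2 hcount τ₁)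
  rw [Finset.map_eq_image, Finset.image_image] at h
  exact h

end Markman

/-! ## §3 Four parts of the products of copies have algebraic lines -/

section Parts

variable {I : Type} {r : ℕ} {Kf : I → Type} [∀ i, Field (Kf i)] [∀ i, NumberField (Kf i)] [∀ i, IsCMField (Kf i)]
  {i₀ i₁ : I} {N : ℕ} (κ : Fin N → Fin (r + 1)) {e : (Kf i₁ →+* ℂ) ≃ Fin 4 × Bool} {τ : Kf i₀ →+* ℂ} {i : Kf i₀ →+* Kf i₁}
  {A : Fin (r + 1) → AbelianVariety ℂ} {Φ : ∀ j : Fin (r + 1), CMType (Kf (multiSlots r i₀ i₁ j))}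
  {ι : ∀ j, 𝓞 (Kf (multiSlots r i₀ i₁ j)) →+* End (A j)}
  {θ : ∀ j, Kf (multiSlots r i₀ i₁ j) →+* Module.End ℂ (complexBetti (A j).X 1)}

omit [∀ i, NumberField (Kf i)] [∀ i, IsCMField (Kf i)] in
/-- The model image of a four part of slot `m`, sign `b`: the four labels `(m, a, b)`. [folklore] -/
theorem _root_.Summit.HodgeConjecture.CorCM.Census.OcticWeilMulti.IsFourPartO.image_eq {α : Type*} {v : α → PtO r} {m : Fin r} {b : Bool} {G : Finset α} (hG : IsFourPartO v m b G) :
    G.image v = (Finset.univ : Finset (Fin 4)).image fun a => (Sum.inr (m, (a, b)) : PtO r) := by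
  ext z
  rw [Finset.mem_image, Finset.mem_image]
  constructor
  · rintro ⟨x, hx, rfl⟩
    obtain ⟨a, ha⟩ := hG.exists_eq_inr hx
    exact ⟨a, Finset.mem_univ _, ha.symm⟩
  · rintro ⟨a, -, rfl⟩
    have h1 : (G.filter fun x => v x = Sum.inr (m, (a, b))).card = 1 := hG.2 a
    obtain ⟨x, hx⟩ := Finset.card_eq_one.1 h1
    have hx' : x ∈ G.filter fun x => v x = Sum.inr (m, (a, b)) := by rw [hx]; exact Finset.mem_singleton_self x
    exact ⟨x, (Finset.mem_filter.1 hx').1, (Finset.mem_filter.1 hx').2⟩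

/-- **A four part of a `(2,2)`-slot of a weight of `X = ⨁_j A(κ j)` has an algebraic line, GIVEN Markman's fourfold theorem**: the
slot projection `P` is injective on it with image the Weil weight `{(m+1, s) | s ∘ i = τ_b}` of `Y` (`IsFourPartO.image_eq`,
`toPtO_injective`), whose line is algebraic (§2); the distribution lemma lifts this along `κ`.
[cite: Milne2020HodgeClassesAV, 1.2 (a) and Thm. 1] [cite: Markman2025SurveySecant, Thm. 1.2] -/
theorem weightClassesAlg_le_algebraicClasses_of_isFourPartO (hW4 : Markman2025_weilClasses_algebraic_abelianFourfold)
    (h8 : Module.finrank ℚ (Kf i₁) = 8) (h2 : Module.finrank ℚ (Kf i₀) = 2)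
    (hττ : ComplexEmbedding.conjugate τ ≠ τ) (hk : ∀ σ : Kf i₀ →+* ℂ, σ = τ ∨ σ = ComplexEmbedding.conjugate τ)
    (he_sign : ∀ s : Kf i₁ →+* ℂ, (e s).2 = true ↔ s.comp i = τ)
    (hA : ∀ j, IsCMTypeRealisation (Φ j) (A j) (ι j) (θ j)) {m : Fin r}
    (hcount : ∀ τ' : Kf i₀ →+* ℂ, (Finset.univ.filter fun s : Kf i₁ →+* ℂ => s.comp i = τ' ∧ s ∈ (Φ m.succ).1).card = 2)
    {b : Bool} {G : Finset ((j : Fin N) × (Kf (multiSlots r i₀ i₁ (κ j)) →+* ℂ))}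
    (hG : IsFourPartO (fun x => toPtO e τ ((Sigma.map κ (fun _ => id) :
      ((j : Fin N) × (Kf (multiSlots r i₀ i₁ (κ j)) →+* ℂ)) → ((l : Fin (r + 1)) × (Kf (multiSlots r i₀ i₁ l) →+* ℂ))) x)) m b G) :
    G.card = 2 * 2 ∧ weightClassesAlg (fun j => A (κ j)) (fun j => ι (κ j)) (2 * 2) G ≤
      algebraicClasses (⨁ fun j => A (κ j)).X 2 := by
  set Pm : ((j : Fin N) × (Kf (multiSlots r i₀ i₁ (κ j)) →+* ℂ)) → ((l : Fin (r + 1)) × (Kf (multiSlots r i₀ i₁ l) →+* ℂ)) :=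
    Sigma.map κ (fun _ => id) with hPm
  have hinjv := hG.injOn
  have hPinj : Set.InjOn Pm ↑G := fun x hx x' hx' h => hinjv hx hx' (by change toPtO e τ (Pm x) = toPtO e τ (Pm x'); rw [h])
  have hq : G.card = 2 * 2 := by rw [hG.1]
  set τb : Kf i₀ →+* ℂ := if b then τ else ComplexEmbedding.conjugate τ with hτb
  -- the image of `G` under `Pm` is the Weil weight of `Y` in slot `m+1` over `τ_b`
  have hGim : (G.image Pm).image (toPtO e τ) =
      (Finset.univ : Finset (Fin 4)).image fun a => (Sum.inr (m, (a, b)) : PtO r) := by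
    rw [Finset.image_image]; exact hG.image_eq
  have himg : G.image Pm = (Finset.univ.filter fun s : Kf i₁ →+* ℂ => s.comp i = τb).image fun s : Kf i₁ →+* ℂ =>
      (⟨m.succ, s⟩ : (l : Fin (r + 1)) × (Kf (multiSlots r i₀ i₁ l) →+* ℂ)) := by
    ext y
    constructor
    · intro hy
      have hty : toPtO e τ y ∈ (Finset.univ : Finset (Fin 4)).image fun a => (Sum.inr (m, (a, b)) : PtO r) :=
        hGim ▸ Finset.mem_image_of_mem _ hy
      obtain ⟨a, -, ha⟩ := Finset.mem_image.1 hty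
      rcases sigma_casesM y with ⟨σ, rfl⟩ | ⟨m', s, rfl⟩
      · rw [toPtO_zero] at ha
        exact absurd ha Sum.inr_ne_inl
      · rw [toPtO_succ, Sum.inr.injEq, Prod.mk.injEq] at ha
        obtain ⟨rfl, ha⟩ := ha
        refine Finset.mem_image.2 ⟨s, Finset.mem_filter.2 ⟨Finset.mem_univ _, ?_⟩, rfl⟩
        exact (snd_eq_iff_comp_eq hk hττ he_sign b s).1 (by rw [← ha])
    · intro hy
      obtain ⟨s, hs, rfl⟩ := Finset.mem_image.1 hy
      have hsb : (e s).2 = b := (snd_eq_iff_comp_eq hk hττ he_sign b s).2 (Finset.mem_filter.1 hs).2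
      have hmem : (Sum.inr (m, e s) : PtO r) ∈ (G.image Pm).image (toPtO e τ) := by
        rw [hGim]
        exact Finset.mem_image.2 ⟨(e s).1, Finset.mem_univ _, by rw [← hsb]⟩
      obtain ⟨y, hy', hty⟩ := Finset.mem_image.1 hmem
      have : y = ⟨m.succ, s⟩ := toPtO_injective hττ hk (by rw [hty, toPtO_succ])
      rwa [this] at hy'
  have hYalg := weightClassesAlg_weilWeightY_le_algebraicClasses_of_markmanO i m hA hW4 h8 h2 hcount τb
  rw [← himg] at hYalg
  exact ⟨hq, weightClassesAlg_comp_le_algebraicClasses_of_injOn (K := fun l => Kf (multiSlots r i₀ i₁ l)) hA κ hq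
    hPinj hYalg⟩

end Parts

end Summit.HodgeConjecture.CorCM.OcticWeilMulti

end
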